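import Literature.MathematicalPhysics.QuantumFieldTheory.WilsonWeakCouplingBounds
import Literature.MathematicalPhysics.QuantumFieldTheory.LatticeMaxwellGaussian
import HarnessLib

/-!
# Chatterjee's free-energy asymptotics: Gaussian factorisation of the chart integrals and the logarithmic two-sided bounds for `log Z(B_n, β)`

S. Chatterjee, *The leading term of the Yang–Mills free energy*, J. Funct. Anal. 271 (2016),
arXiv:1602.01222, §17 (proofs of Lemmas 17.2 and 17.6) — eighth step of the inline proof of the
named fact `Literature.MathematicalPhysics.QuantumFieldTheory.chatterjee_freeEnergyDensity`.
Everything is proved; no named fact is introduced.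

* `measurePreserving_transpose`: transposition `(ι → κ → ℝ) ≃ (κ → ι → ℝ)` preserves Lebesgue
  measure (Haar uniqueness + the unit cube).
* `maxwell_eq_sum_formM`: the matrix Maxwell action of `WilsonWeakCouplingBounds` is the sum over
  the `N²` coordinates of the scalar Maxwell forms of `LatticeMaxwellGaussian` (`idx`, `col`, `Φ`,
  `measurePreserving_Φ`); `maxwell_smul` (quadratic scaling).
* `ZM n = gaussZ (Qmat pinI 0 n)` — the scalar lattice Maxwell partition function `Z_M(B_n)`;
  `lintegral_exp_maxwell` (`∫ e^{-½M_n(H)} dH = Z_M(B_n)^{N²}`), `lintegral_exp_beta_maxwell`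
  (`= β^{-N²|E_n^1|/2} Z_M(B_n)^{N²}` after scaling), `le_setLIntegral_exp_beta_maxwell` (the cube
  version `≥ β^{-N²|E_n^1|/2} (Z_M(B_n) τ_n(|t|_∞ ≤ √β r/N))^{N²}`), `setLIntegral_wM`.
* `logZ_le` (**Lemma 17.2**, logarithmic form, for `β ≥ 2`, `ρ₀ ≤ 1/8`, constant `C71` of
  Thm. 7.1): `log Z(B_n,β) ≤ log 2 + |E_n^1| log c_H + 67βN(2ρ₀)³|B_n'| - ½N²|E_n^1| log β
  + N² log Z_M(B_n)`; `le_logZ` (**Lemma 17.6**, logarithmic form): `|E_n^1|(log c_H - N² log κ(r))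
  - 67βNr³|B_n'| - ½N²|E_n^1| log β + N²(log Z_M(B_n) + log L) ≤ log Z(B_n,β)` for any positive
  `L ≤ τ_n(|t|_∞ ≤ √β r/N)` (supplied by Theorem 14.3 downstream). `c_H = haarChartConst N` is the
  soft Haar constant of the Cayley chart (`UnitaryCayleyChart`).

## References

* S. Chatterjee, *The leading term of the Yang–Mills free energy*, J. Funct. Anal. 271 (2016)
  2944–3005, arXiv:1602.01222, §15 (`Z_M(B_n)`), §17 (Lemmas 17.2, 17.6). [arXiv160201222]
-/

noncomputable section

open MeasureTheory Measure ProbabilityTheory Finset Matrix WithLp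
open scoped ENNReal NNReal Matrix.Norms.Frobenius
open Literature.Probability.LatticeModels Literature.MathematicalPhysics.QuantumLattice

namespace Literature.MathematicalPhysics.QuantumFieldTheory

namespace ChatterjeeAssembly

open UnitaryCayley AxialGauge WilsonWeakCoupling GaussianToolkit LatticeMaxwell

variable {d N : ℕ}

/-- Sites of `ℤ^d`. -/
local notation "ZSite" => Literature.Probability.LatticeModels.Site

/-! ### Transposition of doubly indexed families preserves Lebesgue measure -/

section Transpose

variable (ι κ : Type*) [Fintype ι] [Fintype κ]

/-- Transposition of a doubly indexed real family, as a linear equivalence. [folklore] -/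
def transposeL : (ι → κ → ℝ) ≃ₗ[ℝ] (κ → ι → ℝ) where
  toFun a k i := a i k
  invFun b i k := b k i
  map_add' _ _ := rfl
  map_smul' _ _ := rfl
  left_inv _ := rfl
  right_inv _ := rfl

/-- Transposition as a continuous linear equivalence. [folklore] -/
def transposeCL : (ι → κ → ℝ) ≃L[ℝ] (κ → ι → ℝ) := (transposeL ι κ).toContinuousLinearEquiv

/-- `transposeCL a k i = a i k`. [folklore] -/
@[simp] theorem transposeCL_apply (a : ι → κ → ℝ) (k : κ) (i : ι) : transposeCL ι κ a k i = a i k := rfl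

/-- **Transposition preserves Lebesgue measure** (`volume` on `ι → κ → ℝ` is the product of the
products; proof by uniqueness of Haar measure and evaluation on the unit cube). [folklore] -/
theorem measurePreserving_transpose :
    MeasurePreserving (transposeCL ι κ) (volume : Measure (ι → κ → ℝ)) (volume : Measure (κ → ι → ℝ)) := by
  set T := transposeCL ι κ with hT
  refine ⟨T.continuous.measurable, ?_⟩
  haveI : IsAddHaarMeasure (volume : Measure (ι → κ → ℝ)) := Measure.pi.isAddHaarMeasure _
  haveI : IsAddHaarMeasure (volume : Measure (κ → ι → ℝ)) := Measure.pi.isAddHaarMeasure _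
  haveI : IsAddHaarMeasure ((volume : Measure (ι → κ → ℝ)).map T) := T.isAddHaarMeasure_map _
  have hc := Measure.isAddLeftInvariant_eq_smul ((volume : Measure (ι → κ → ℝ)).map T) volume
  set c := Measure.addHaarScalarFactor ((volume : Measure (ι → κ → ℝ)).map T) volume with hcdef
  set S : Set (κ → ι → ℝ) := Set.pi Set.univ fun _ => Set.pi Set.univ fun _ => Set.Icc (0 : ℝ) 1 with hS
  have hSm : MeasurableSet S :=
    MeasurableSet.univ_pi fun _ => MeasurableSet.univ_pi fun _ => measurableSet_Icc
  have hcubeι : (volume : Measure (ι → ℝ)) (Set.pi Set.univ fun _ => Set.Icc (0 : ℝ) 1) = 1 := by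
    rw [volume_pi_pi]; simp [Real.volume_Icc]
  have hcubeκ : (volume : Measure (κ → ℝ)) (Set.pi Set.univ fun _ => Set.Icc (0 : ℝ) 1) = 1 := by
    rw [volume_pi_pi]; simp [Real.volume_Icc]
  have hνS : (volume : Measure (κ → ι → ℝ)) S = 1 := by
    rw [hS, volume_pi_pi]
    exact Finset.prod_eq_one fun k _ => hcubeι
  have hpre : T ⁻¹' S = Set.pi Set.univ fun _ => Set.pi Set.univ fun _ => Set.Icc (0 : ℝ) 1 := by
    ext a
    simp only [hS, hT, Set.mem_preimage, Set.mem_pi, Set.mem_univ, forall_true_left, Set.mem_Icc, transposeCL_apply]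
    exact ⟨fun h i k => h k i, fun h k i => h i k⟩
  have hμS : ((volume : Measure (ι → κ → ℝ)).map T) S = 1 := by
    rw [Measure.map_apply T.continuous.measurable hSm, hpre, volume_pi_pi]
    exact Finset.prod_eq_one fun i _ => hcubeκ
  have hc1 : c = 1 := by
    have h := congr_arg (fun m : Measure (κ → ι → ℝ) => m S) hc
    simp only [Measure.smul_apply, hμS, hνS] at h
    have h' : ((c : ℝ≥0∞)) = 1 := by simpa [ENNReal.smul_def] using h.symm
    exact_mod_cast h'
  rw [hc, hc1, one_smul]

end Transpose

/-! ### The matrix Maxwell action is a sum of `N²` scalar Maxwell forms -/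

section Columns

variable (n : ℕ)

/-- The free edges of `WilsonWeakCouplingBounds` and of `LatticeMaxwellGaussian` (corner `0`,
comb tree pinned) are the same index set. [folklore] -/
def idx : FreeIdx d n ≃ Free (pinI (d := d)) (0 : ZSite d) n where
  toFun e := ⟨⟨e.1.1, mem_boxEdgesAt_zero.2 e.1.2⟩, e.2⟩
  invFun e := ⟨⟨e.1.1, mem_boxEdgesAt_zero.1 e.1.2⟩, e.2⟩
  left_inv _ := rfl
  right_inv _ := rfl

variable {n}

/-- The `c`-th coordinate column of a matrix configuration, on the scalar index set. [folklore] -/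
def col (a : FreeIdx d n → 𝔼 N) (c : Fin N × Fin N) : Free (pinI (d := d)) (0 : ZSite d) n → ℝ :=
  fun e' => a ((idx n).symm e') c

/-- Coordinates of the zero extension are the glued scalar columns. [folklore] -/
theorem zeroExt_apply_coord (a : FreeIdx d n → 𝔼 N) (e : ZdEdge d) (c : Fin N × Fin N) :
    zeroExt a e c = LatticeMaxwell.glue (pin := pinI (d := d)) (0 : ZSite d) n 0 (col a c) e := by
  unfold zeroExt LatticeMaxwell.glue
  by_cases h : e ∈ boxEdges d n
  · have h' : e ∈ boxEdgesAt (0 : ZSite d) n := mem_boxEdgesAt_zero.2 h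
    by_cases hc : IsComb e
    · have hc' : pinI e := hc
      simp [h, h', hc, hc']
    · have hc' : ¬ pinI e := hc
      simp only [h, h', hc, hc', dif_pos, dif_neg, not_false_eq_true, col]
      rfl
  · have h' : e ∉ boxEdgesAt (0 : ZSite d) n := fun h'' => h (mem_boxEdgesAt_zero.1 h'')
    simp [h, h']

/-- Coordinates of the matrix circulation are scalar circulations. [folklore] -/
theorem circ_apply_coord (a : FreeIdx d n → 𝔼 N) (p : Plaq d) (c : Fin N × Fin N) :
    circ (zeroExt a) p c = sCirc (LatticeMaxwell.glue (pin := pinI (d := d)) (0 : ZSite d) n 0 (col a c)) p := by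
  simp only [circ, sCirc, PiLp.sub_apply, PiLp.add_apply, zeroExt_apply_coord]

/-- **The matrix Maxwell action is the sum over the `N²` coordinates of the scalar Maxwell forms of
the columns**: `M_n(H) = Σ_c M_n(H^c)`. [cite: arXiv160201222, §16–17 (proof of Lemma 17.2)] -/
theorem maxwell_eq_sum_formM (a : FreeIdx d n → 𝔼 N) :
    maxwell d N n a = ∑ c : Fin N × Fin N, formM (pinI (d := d)) (0 : ZSite d) n 0 (col a c) := by
  unfold maxwell formM
  rw [Finset.sum_comm]
  refine Finset.sum_congr rfl fun p _ => ?_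
  rw [EuclideanSpace.real_norm_sq_eq]
  refine Finset.sum_congr rfl fun c _ => ?_
  rw [shift_zero, circ_apply_coord]

/-- Scaling of the zero extension. [folklore] -/
theorem zeroExt_smul (r : ℝ) (a : FreeIdx d n → 𝔼 N) (e : ZdEdge d) : zeroExt (r • a) e = r • zeroExt a e := by
  unfold zeroExt
  split_ifs <;> simp

/-- **The Maxwell action is a quadratic form**: `M(rH) = r² M(H)`. [folklore] -/
theorem maxwell_smul (r : ℝ) (a : FreeIdx d n → 𝔼 N) : maxwell d N n (r • a) = r ^ 2 * maxwell d N n a := by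
  unfold maxwell
  rw [Finset.mul_sum]
  refine Finset.sum_congr rfl fun p _ => ?_
  have : circ (zeroExt (r • a)) p = r • circ (zeroExt a) p := by
    simp only [circ, zeroExt_smul, smul_add, smul_sub]
  rw [this, norm_smul, mul_pow, Real.norm_eq_abs, sq_abs]

end Columns

/-! ### The scalar lattice Maxwell partition function and the Gaussian factorisation -/

section Factorisation

/-- A constant-family `piCongrLeft` evaluates by precomposition with the inverse. [folklore] -/
theorem piCongrLeft_const_apply {α β : Type*} (f : α ≃ β) (s : α → ℝ) (b : β) :
    MeasurableEquiv.piCongrLeft (fun _ => ℝ) f s b = s (f.symm b) := by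
  rw [MeasurableEquiv.coe_piCongrLeft]
  conv_lhs => rw [← f.apply_symm_apply b]
  rw [Equiv.piCongrLeft_apply_apply]

variable (N) (n : ℕ)

/-- The transport `Φ(a)(c)(e) = a_e^c`: a matrix configuration on the free edges as an `N²`-tuple
of scalar configurations. [folklore] -/
def Φ (a : FreeIdx d n → 𝔼 N) : Fin N × Fin N → (Free (pinI (d := d)) (0 : ZSite d) n → ℝ) :=
  fun c e' => a ((idx n).symm e') c

/-- `Φ` as a composition of three measure-preserving maps. [folklore] -/
theorem Φ_eq_comp : Φ (d := d) N n =
    (fun (b : Fin N × Fin N → FreeIdx d n → ℝ) (c : Fin N × Fin N) =>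
        MeasurableEquiv.piCongrLeft (fun _ => ℝ) (idx n) (b c)) ∘
      (transposeCL (FreeIdx d n) (Fin N × Fin N)) ∘
      (fun (a : FreeIdx d n → 𝔼 N) (e : FreeIdx d n) => WithLp.ofLp (a e)) := by
  funext a c e'
  simp only [Function.comp_apply, Φ, piCongrLeft_const_apply, transposeCL_apply]

/-- **`Φ` preserves Lebesgue measure.** [folklore] -/
theorem measurePreserving_Φ : MeasurePreserving (Φ (d := d) N n) volume volume := by
  have h1 : MeasurePreserving (fun (a : FreeIdx d n → 𝔼 N) (e : FreeIdx d n) => WithLp.ofLp (a e)) volume volume :=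
    volume_preserving_pi fun _ : FreeIdx d n => PiLp.volume_preserving_ofLp (Fin N × Fin N)
  have h2 := measurePreserving_transpose (FreeIdx d n) (Fin N × Fin N)
  have h3 : MeasurePreserving (fun (b : Fin N × Fin N → FreeIdx d n → ℝ) (c : Fin N × Fin N) =>
      MeasurableEquiv.piCongrLeft (fun _ => ℝ) (idx n) (b c)) volume volume :=
    volume_preserving_pi fun _ : Fin N × Fin N => volume_measurePreserving_piCongrLeft (fun _ => ℝ) (idx n)
  rw [Φ_eq_comp]
  exact (h3.comp h2).comp h1

/-- `Φ` is measurable. [folklore] -/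
theorem measurable_Φ : Measurable (Φ (d := d) N n) := (measurePreserving_Φ N n).measurable

variable {N n}

variable (n) in
/-- **The scalar lattice Maxwell partition function** `Z_M(B_n) = ∫_{ℝ^{E_n^1}} e^{-½M_n(t)} dt`
(Chatterjee §15, `Z_M(B_n)`; as `gaussZ` of the precision matrix). [cite: arXiv160201222, §15] -/
def ZM : ℝ≥0∞ := gaussZ (Qmat (pinI (d := d)) (0 : ZSite d) n)

variable (n) in
/-- The scalar Gaussian weight `e^{-½ M_n(t)}` on `ℝ^{E_n^1}`. [cite: arXiv160201222, §15] -/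
def wM (t : Free (pinI (d := d)) (0 : ZSite d) n → ℝ) : ℝ≥0∞ :=
  ENNReal.ofReal (Real.exp (-(formM (pinI (d := d)) (0 : ZSite d) n 0 t) / 2))

/-- `wM` is measurable. [folklore] -/
theorem measurable_wM : Measurable (wM (d := d) n) := by
  unfold wM
  refine ENNReal.measurable_ofReal.comp (Real.measurable_exp.comp ?_)
  exact ((continuous_formM _).measurable.neg).div_const _

/-- `Z_M(B_n) ∈ (0, ∞)`. [folklore] -/
theorem ZM_ne_zero_and_ne_top : ZM (d := d) n ≠ 0 ∧ ZM (d := d) n ≠ ∞ := by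
  obtain ⟨-, h0, htop⟩ := τ_eq_withDensity (pin := pinI (d := d)) (a := (0 : ZSite d)) (n := n) (hpinI _)
  exact ⟨h0, htop⟩

/-- Integrals of the scalar weight over events are `Z_M · τ_n` of the Euclidean events. [folklore] -/
theorem setLIntegral_wM (G : Set (Free (pinI (d := d)) (0 : ZSite d) n → ℝ)) (hG : MeasurableSet G) :
    ∫⁻ t in G, wM n t = ZM (d := d) n * τ (pinI (d := d)) (0 : ZSite d) n ((WithLp.ofLp) ⁻¹' G) := by
  obtain ⟨hτ, hZ0, hZtop⟩ := τ_eq_withDensity (pin := pinI (d := d)) (a := (0 : ZSite d)) (n := n) (hpinI _)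
  set Q := Qmat (pinI (d := d)) (0 : ZSite d) n with hQ
  have hW : (volume : Measure (EuclideanSpace ℝ (Free (pinI (d := d)) (0 : ZSite d) n))).withDensity (gaussWeight Q) =
      gaussZ Q • τ (pinI (d := d)) (0 : ZSite d) n := by
    rw [hτ, smul_smul, ENNReal.mul_inv_cancel hZ0 hZtop, one_smul]
  have hG' : MeasurableSet ((WithLp.ofLp) ⁻¹' G : Set (EuclideanSpace ℝ (Free (pinI (d := d)) (0 : ZSite d) n))) :=
    (PiLp.continuous_ofLp 2 _).measurable hG
  have hmp := PiLp.volume_preserving_toLp (Free (pinI (d := d)) (0 : ZSite d) n)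
  have hemb := (MeasurableEquiv.toLp 2 (Free (pinI (d := d)) (0 : ZSite d) n → ℝ)).measurableEmbedding
  have hpre : (WithLp.toLp 2) ⁻¹' ((WithLp.ofLp) ⁻¹' G : Set (EuclideanSpace ℝ (Free (pinI (d := d)) (0 : ZSite d) n))) = G := by
    ext t; simp
  calc ∫⁻ t in G, wM n t
      = ∫⁻ t in (WithLp.toLp 2) ⁻¹' ((WithLp.ofLp) ⁻¹' G : Set (EuclideanSpace ℝ (Free (pinI (d := d)) (0 : ZSite d) n))),
          gaussWeight Q (WithLp.toLp 2 t) := by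
        rw [hpre]
        refine setLIntegral_congr_fun hG (fun t _ => ?_)
        rw [gaussWeight_Qmat, WithLp.ofLp_toLp, wM]
    _ = ∫⁻ y in (WithLp.ofLp) ⁻¹' G, gaussWeight Q y := hmp.setLIntegral_comp_preimage_emb hemb _ _
    _ = ((volume : Measure (EuclideanSpace ℝ (Free (pinI (d := d)) (0 : ZSite d) n))).withDensity (gaussWeight Q)) ((WithLp.ofLp) ⁻¹' G) :=
        (withDensity_apply _ hG').symm
    _ = gaussZ Q * τ (pinI (d := d)) (0 : ZSite d) n ((WithLp.ofLp) ⁻¹' G) := by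
        rw [hW, Measure.smul_apply, smul_eq_mul]

/-- `∫ e^{-½M_n} dt = Z_M(B_n)`. [cite: arXiv160201222, §15] -/
theorem lintegral_wM : ∫⁻ t, wM (d := d) n t = ZM (d := d) n := by
  rw [← setLIntegral_univ, setLIntegral_wM _ MeasurableSet.univ, Set.preimage_univ, measure_univ, mul_one]

/-- The matrix Gaussian weight is the product of the scalar weights of the columns. [cite: arXiv160201222, §17 (proof of Lemma 17.2)] -/
theorem ofReal_exp_maxwell (a : FreeIdx d n → 𝔼 N) :
    ENNReal.ofReal (Real.exp (-(maxwell d N n a) / 2)) = ∏ c, wM n (Φ N n a c) := by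
  unfold wM
  rw [← ENNReal.ofReal_prod_of_nonneg (fun _ _ => (Real.exp_pos _).le), ← Real.exp_sum]
  congr 1
  have hc : ∀ c : Fin N × Fin N, -(formM (pinI (d := d)) (0 : ZSite d) n 0 (Φ N n a c)) / 2 =
      (-(1 : ℝ) / 2) * formM (pinI (d := d)) (0 : ZSite d) n 0 (col a c) := fun c => by
    rw [show Φ N n a c = col a c from rfl]; ring
  simp_rw [hc]
  rw [← Finset.mul_sum, maxwell_eq_sum_formM]
  ring

/-- **Gaussian factorisation**: `∫ e^{-½M_n(H)} dH = Z_M(B_n)^{N²}`. [cite: arXiv160201222, §17 (proof of Lemma 17.2)] -/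
theorem lintegral_exp_maxwell :
    ∫⁻ a : FreeIdx d n → 𝔼 N, ENNReal.ofReal (Real.exp (-(maxwell d N n a) / 2)) = ZM (d := d) n ^ (N * N) := by
  simp_rw [ofReal_exp_maxwell]
  have h := (measurePreserving_Φ (d := d) N n).lintegral_comp (f := fun T => ∏ c, wM n (T c))
    (Finset.measurable_prod _ fun c _ => measurable_wM.comp (measurable_pi_apply c))
  rw [h, volume_pi, lintegral_fintype_prod_eq_prod _ (fun _ => measurable_wM)]
  simp only [lintegral_wM, Finset.prod_const, Finset.card_univ, Fintype.card_prod, Fintype.card_fin]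

/-- **Scaling**: `∫ e^{-½βM_n(H)} dH = β^{-N²|E_n^1|/2} Z_M(B_n)^{N²}` for `β > 0`. [cite: arXiv160201222, §17 (proof of Lemma 17.2)] -/
theorem lintegral_exp_beta_maxwell {β : ℝ} (hβ : 0 < β) :
    ∫⁻ a : FreeIdx d n → 𝔼 N, ENNReal.ofReal (Real.exp (-β * maxwell d N n a / 2)) =
      ENNReal.ofReal ((Real.sqrt β ^ (Fintype.card (FreeIdx d n) * (N * N)))⁻¹) * ZM (d := d) n ^ (N * N) := by
  have hsq : 0 < Real.sqrt β := Real.sqrt_pos.2 hβ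
  have hscale : ∀ a : FreeIdx d n → 𝔼 N, Real.exp (-β * maxwell d N n a / 2) =
      Real.exp (-(maxwell d N n (Real.sqrt β • a)) / 2) := fun a => by
    rw [maxwell_smul, Real.sq_sqrt hβ.le]; ring_nf
  simp_rw [hscale]
  have hfin : Module.finrank ℝ (FreeIdx d n → 𝔼 N) = Fintype.card (FreeIdx d n) * (N * N) := by
    rw [Module.finrank_pi_fintype, Finset.sum_const, Finset.card_univ, finrank_𝔼, smul_eq_mul]
  rw [lintegral_comp_smul volume (fun a : FreeIdx d n → 𝔼 N => ENNReal.ofReal (Real.exp (-(maxwell d N n a) / 2))) hsq.ne',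
    lintegral_exp_maxwell, hfin, abs_of_pos (by positivity)]

/-- Vectors with small coordinates have small norm: `(∀ c, |v_c| ≤ ρ) ⇒ ‖v‖ ≤ Nρ` on `𝔼 N`. [folklore] -/
theorem norm_le_of_coord_le {v : 𝔼 N} {ρ : ℝ} (hρ : 0 ≤ ρ) (h : ∀ c, |v c| ≤ ρ) : ‖v‖ ≤ N * ρ := by
  have hsq : ‖v‖ ^ 2 ≤ (N * ρ) ^ 2 := by
    rw [EuclideanSpace.real_norm_sq_eq]
    calc ∑ c, v c ^ 2 ≤ ∑ _c : Fin N × Fin N, ρ ^ 2 := Finset.sum_le_sum fun c _ => by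
          have := h c; rw [← sq_abs]; nlinarith [abs_nonneg (v c)]
      _ = (N * ρ) ^ 2 := by
          rw [Finset.sum_const, Finset.card_univ, Fintype.card_prod, Fintype.card_fin, nsmul_eq_mul]; push_cast; ring
  exact (abs_le_of_sq_le_sq' hsq (by positivity)).2

/-- **Gaussian factorisation on cubes**: for `β > 0`, `N ≥ 1`, `r ≥ 0`,
`β^{-N²|E_n^1|/2} (Z_M(B_n) τ_n(|t|_∞ ≤ √β r/N))^{N²} ≤ ∫_{‖H_e‖ ≤ r} e^{-½βM_n(H)} dH`. [cite: arXiv160201222, §17 (proof of Lemma 17.6)] -/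
theorem le_setLIntegral_exp_beta_maxwell {β : ℝ} (hβ : 0 < β) (hN : 1 ≤ N) {r : ℝ} (hr : 0 ≤ r) :
    ENNReal.ofReal ((Real.sqrt β ^ (Fintype.card (FreeIdx d n) * (N * N)))⁻¹) *
        (ZM (d := d) n * τ (pinI (d := d)) (0 : ZSite d) n
          {y | ∀ e, |y e| ≤ Real.sqrt β * r / N}) ^ (N * N) ≤
      ∫⁻ a in Set.pi Set.univ (fun _ : FreeIdx d n => Metric.closedBall (0 : 𝔼 N) r),
        ENNReal.ofReal (Real.exp (-β * maxwell d N n a / 2)) := by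
  have hsq : 0 < Real.sqrt β := Real.sqrt_pos.2 hβ
  have hNpos : (0 : ℝ) < N := by exact_mod_cast hN
  set R := Real.sqrt β * r / N with hR
  have hR0 : 0 ≤ R := by positivity
  set S := Set.pi Set.univ (fun _ : FreeIdx d n => Metric.closedBall (0 : 𝔼 N) r) with hS
  set S' := {x : FreeIdx d n → 𝔼 N | ∀ e, ‖x e‖ ≤ Real.sqrt β * r} with hS'
  set g := fun a : FreeIdx d n → 𝔼 N => ENNReal.ofReal (Real.exp (-(maxwell d N n a) / 2)) with hg
  have hgm : Measurable g := by
    refine ENNReal.measurable_ofReal.comp (Real.measurable_exp.comp ?_)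
    exact ((continuous_maxwell n).measurable.neg).div_const _
  have hS'm : MeasurableSet S' := by
    have : S' = ⋂ e, {x : FreeIdx d n → 𝔼 N | ‖x e‖ ≤ Real.sqrt β * r} := by ext; simp [hS']
    rw [this]; exact MeasurableSet.iInter fun e => measurableSet_le (by fun_prop) measurable_const
  -- rescale: `1_S(a) e^{-½βM(a)} = (1_{S'} g)(√β a)`
  have hresc : ∀ a : FreeIdx d n → 𝔼 N, S.indicator (fun a => ENNReal.ofReal (Real.exp (-β * maxwell d N n a / 2))) a =
      S'.indicator g (Real.sqrt β • a) := by
    intro a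
    have hmem : a ∈ S ↔ Real.sqrt β • a ∈ S' := by
      simp only [hS, hS', Set.mem_pi, Set.mem_univ, forall_true_left, mem_closedBall_zero_iff, Set.mem_setOf_eq,
        Pi.smul_apply, norm_smul, Real.norm_eq_abs, abs_of_pos hsq]
      constructor
      · intro h e; exact mul_le_mul_of_nonneg_left (h e) hsq.le
      · intro h e; exact le_of_mul_le_mul_left (h e) hsq
    by_cases ha : a ∈ S
    · rw [Set.indicator_of_mem ha, Set.indicator_of_mem (hmem.1 ha), hg]
      dsimp only
      rw [maxwell_smul, Real.sq_sqrt hβ.le]; ring_nf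
    · rw [Set.indicator_of_notMem ha, Set.indicator_of_notMem (fun h => ha (hmem.2 h))]
  have hSm : MeasurableSet S := MeasurableSet.univ_pi fun _ => Metric.isClosed_closedBall.measurableSet
  rw [← lintegral_indicator hSm]
  simp_rw [hresc]
  have hfin : Module.finrank ℝ (FreeIdx d n → 𝔼 N) = Fintype.card (FreeIdx d n) * (N * N) := by
    rw [Module.finrank_pi_fintype, Finset.sum_const, Finset.card_univ, finrank_𝔼, smul_eq_mul]
  rw [lintegral_comp_smul volume (S'.indicator g) hsq.ne', hfin, abs_of_pos (by positivity), lintegral_indicator hS'm]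
  gcongr
  -- the box `B ⊆ S'`
  set cube : Set (Free (pinI (d := d)) (0 : ZSite d) n → ℝ) := {t | ∀ e, |t e| ≤ R} with hcube
  have hcubem : MeasurableSet cube := by
    have : cube = ⋂ e, {t : Free (pinI (d := d)) (0 : ZSite d) n → ℝ | |t e| ≤ R} := by ext; simp [hcube]
    rw [this]; exact MeasurableSet.iInter fun e => measurableSet_le (by fun_prop) measurable_const
  set B := {x : FreeIdx d n → 𝔼 N | ∀ c, Φ N n x c ∈ cube} with hB
  have hBS' : B ⊆ S' := by
    intro x hx e
    have h' : ∀ c, |x e c| ≤ R := fun c => by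
      have := hx c ((idx n) e)
      simp only [Φ, Equiv.symm_apply_apply] at this
      exact this
    calc ‖x e‖ ≤ N * R := norm_le_of_coord_le hR0 h'
      _ = Real.sqrt β * r := by rw [hR]; field_simp
  calc (ZM (d := d) n * τ (pinI (d := d)) (0 : ZSite d) n {y | ∀ e, |y e| ≤ Real.sqrt β * r / N}) ^ (N * N)
      = ∏ _c : Fin N × Fin N, ∫⁻ t, cube.indicator (wM n) t := by
        rw [Finset.prod_const, Finset.card_univ, Fintype.card_prod, Fintype.card_fin, lintegral_indicator hcubem,
          setLIntegral_wM _ hcubem]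
        rfl
    _ = ∫⁻ T : Fin N × Fin N → (Free (pinI (d := d)) (0 : ZSite d) n → ℝ), ∏ c, cube.indicator (wM n) (T c) :=
        (lintegral_fintype_prod_eq_prod (fun _ : Fin N × Fin N =>
          (volume : Measure (Free (pinI (d := d)) (0 : ZSite d) n → ℝ))) (fun _ => measurable_wM.indicator hcubem)).symm
    _ = ∫⁻ x : FreeIdx d n → 𝔼 N, ∏ c, cube.indicator (wM n) (Φ N n x c) :=
        ((measurePreserving_Φ (d := d) N n).lintegral_comp
          (Finset.measurable_prod _ fun c _ => (measurable_wM.indicator hcubem).comp (measurable_pi_apply c))).symm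
    _ = ∫⁻ x in B, g x := by
        rw [← lintegral_indicator ((measurable_Φ N n) (MeasurableSet.univ_pi fun _ => hcubem) |> fun h => by
          have : B = Φ N n ⁻¹' Set.pi Set.univ (fun _ => cube) := by ext; simp [hB]
          rw [this]; exact h)]
        refine lintegral_congr fun x => ?_
        by_cases hx : x ∈ B
        · rw [Set.indicator_of_mem hx, hg]
          dsimp only
          rw [ofReal_exp_maxwell]
          exact Finset.prod_congr rfl fun c _ => Set.indicator_of_mem (hx c) _
        · rw [Set.indicator_of_notMem hx]
          simp only [hB, Set.mem_setOf_eq, not_forall] at hx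
          obtain ⟨c, hc⟩ := hx
          exact Finset.prod_eq_zero (Finset.mem_univ c) (Set.indicator_of_notMem hc _)
    _ ≤ ∫⁻ x in S', g x := lintegral_mono_set hBS'

end Factorisation

/-! ### Logarithmic form of the Gaussian bounds for `log Z(B_n, β)` -/

section LogBounds

variable (d N)

/-- The constant of Theorem 7.1 (`exists_Z_ge`). [cite: arXiv160201222, Thm. 7.1] -/
def C71 : ℝ := Classical.choose (exists_Z_ge (d := d) (N := N))

/-- The defining property of `C71`. [cite: arXiv160201222, Thm. 7.1] -/
theorem C71_spec : 0 < C71 d N ∧ ∀ (n : ℕ) (β : ℝ), 2 ≤ β →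
    ENNReal.ofReal (Real.exp (-(C71 d N * n ^ d * Real.log β))) ≤ Z d N n β :=
  Classical.choose_spec (exists_Z_ge (d := d) (N := N))

/-- `log Z(B_n, β)` (real logarithm of the free-boundary partition function of the cube). [cite: arXiv160201222, §2] -/
def logZ (n : ℕ) (β : ℝ) : ℝ := Real.log (Z d N n β).toReal

/-- The number of free edges `|E_n^1|`. [cite: arXiv160201222, Lemma 17.1] -/
def D₁ (n : ℕ) : ℕ := Fintype.card (FreeIdx d n)

/-- The number of plaquettes `|B_n'|`. [cite: arXiv160201222, §2] -/
def Pn (n : ℕ) : ℕ := #(plaquettesIn (halfOpenBox d n))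

/-- `F_M`-type quantity: `log Z_M(B_n)` (real). [cite: arXiv160201222, §15] -/
def logZM (n : ℕ) : ℝ := Real.log (ZM (d := d) n).toReal

variable {d N}

/-- The soft Haar constant of the chart as a positive real. [folklore] -/
theorem hcc_pos : 0 < ((haarChartConst N : ℝ≥0) : ℝ) := by exact_mod_cast haarChartConst_pos (N := N)

/-- `Z(B_n, β) ∈ (0, ∞)` for `β ≥ 2`. [folklore] -/
theorem Z_toReal_pos {n : ℕ} {β : ℝ} (hβ : 2 ≤ β) : 0 < (Z d N n β).toReal := by
  have h := (C71_spec d N).2 n β hβ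
  have hpos : 0 < Z d N n β := lt_of_lt_of_le (ENNReal.ofReal_pos.2 (Real.exp_pos _)) h
  exact ENNReal.toReal_pos hpos.ne' (ne_top_of_le_ne_top ENNReal.one_ne_top (Z_le_one n (by linarith)))

/-- `Z_M(B_n).toReal > 0`. [folklore] -/
theorem ZM_toReal_pos {n : ℕ} : 0 < (ZM (d := d) n).toReal :=
  ENNReal.toReal_pos (ZM_ne_zero_and_ne_top (d := d) (n := n)).1 (ZM_ne_zero_and_ne_top (d := d) (n := n)).2

/-- **Upper bound (Lemma 17.2 in logarithmic form)**: for `β ≥ 2` and `ρ₀ ≤ 1/8`,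
`log Z(B_n,β) ≤ log 2 + |E_n^1| log c_H + 67βN(2ρ₀)³|B_n'| - ½N²|E_n^1| log β + N² log Z_M(B_n)`. [cite: arXiv160201222, Lemma 17.2] -/
theorem logZ_le (n : ℕ) {β : ℝ} (hβ : 2 ≤ β) (hρ : rho0 (C71 d N) d n β ≤ 1 / 8) :
    logZ d N n β ≤ Real.log 2 + D₁ d n * Real.log ((haarChartConst N : ℝ≥0) : ℝ) +
      67 * β * N * (2 * rho0 (C71 d N) d n β) ^ 3 * Pn d n - (D₁ d n * (N * N) / 2) * Real.log β +
        (N * N) * logZM d n := by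
  have hβ0 : 0 < β := by linarith
  have h := Z_le_gaussian (d := d) (N := N) (C71_spec d N).2 n hβ hρ
  rw [lintegral_exp_beta_maxwell hβ0] at h
  -- everything is finite
  obtain ⟨hZM0, hZMtop⟩ := ZM_ne_zero_and_ne_top (d := d) (n := n)
  set T := 67 * β * N * (2 * rho0 (C71 d N) d n β) ^ 3 * (#(plaquettesIn (halfOpenBox d n)) : ℝ) with hT
  set cβ := (Real.sqrt β ^ (Fintype.card (FreeIdx d n) * (N * N)))⁻¹ with hcβ
  have hcβpos : 0 < cβ := by rw [hcβ]; positivity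
  have hRtop : 2 * ((haarChartConst N : ℝ≥0∞) ^ Fintype.card (FreeIdx d n) *
      (ENNReal.ofReal (Real.exp T) * (ENNReal.ofReal cβ * ZM (d := d) n ^ (N * N)))) ≠ ∞ := by
    apply ENNReal.mul_ne_top ENNReal.ofNat_ne_top
    apply ENNReal.mul_ne_top (ENNReal.pow_ne_top ENNReal.coe_ne_top)
    apply ENNReal.mul_ne_top ENNReal.ofReal_ne_top
    exact ENNReal.mul_ne_top ENNReal.ofReal_ne_top (ENNReal.pow_ne_top hZMtop)
  have h2 := ENNReal.toReal_mono hRtop h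
  have hZpos := Z_toReal_pos (d := d) (N := N) (n := n) hβ
  rw [logZ]
  refine (Real.log_le_log hZpos h2).trans (le_of_eq ?_)
  rw [ENNReal.toReal_mul, ENNReal.toReal_mul, ENNReal.toReal_mul, ENNReal.toReal_mul, ENNReal.toReal_pow,
    ENNReal.toReal_pow, ENNReal.toReal_ofReal (Real.exp_pos _).le, ENNReal.toReal_ofReal hcβpos.le, ENNReal.coe_toReal,
    ENNReal.toReal_ofNat]
  have hhcc := hcc_pos (N := N)
  have hZMr := ZM_toReal_pos (d := d) (n := n)
  rw [Real.log_mul (by positivity) (by positivity), Real.log_mul (by positivity) (by positivity),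
    Real.log_mul (by positivity) (by positivity), Real.log_mul (by positivity) (by positivity),
    Real.log_pow, Real.log_exp, Real.log_pow, hcβ, Real.log_inv, Real.log_pow, Real.log_sqrt hβ0.le]
  simp only [D₁, Pn, logZM, hT]
  push_cast
  ring

/-- **Lower bound (Lemma 17.6 in logarithmic form)**: for `β > 0`, `N ≥ 1`, `0 < r ≤ 1/2` and any
positive lower bound `L ≤ τ_n(|t|_∞ ≤ √β r/N)`,
`|E_n^1|(log c_H - N² log κ(r)) - 67βNr³|B_n'| - ½N²|E_n^1| log β + N²(log Z_M(B_n) + log L) ≤ log Z(B_n,β)`. [cite: arXiv160201222, Lemma 17.6] -/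
theorem le_logZ (n : ℕ) {β : ℝ} (hβ : 2 ≤ β) (hN : 1 ≤ N) {r : ℝ} (hr : 0 < r) (hr2 : r ≤ 1 / 2)
    {L : ℝ≥0∞} (hL0 : L ≠ 0)
    (hL : L ≤ τ (pinI (d := d)) (0 : ZSite d) n {y | ∀ e, |y e| ≤ Real.sqrt β * r / N}) :
    D₁ d n * (Real.log ((haarChartConst N : ℝ≥0) : ℝ) - (N * N) * Real.log (κ r)) - 67 * β * N * r ^ 3 * Pn d n -
        (D₁ d n * (N * N) / 2) * Real.log β + (N * N) * (logZM d n + Real.log L.toReal) ≤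
      logZ d N n β := by
  have hβ0 : 0 < β := by linarith
  have h := gaussian_le_Z (d := d) (N := N) n hβ0.le hr hr2
  have hcube := le_setLIntegral_exp_beta_maxwell (d := d) (n := n) hβ0 hN hr.le
  obtain ⟨hZM0, hZMtop⟩ := ZM_ne_zero_and_ne_top (d := d) (n := n)
  have hLtop : L ≠ ∞ := ne_top_of_le_ne_top (measure_ne_top _ _) hL
  set cβ := (Real.sqrt β ^ (Fintype.card (FreeIdx d n) * (N * N)))⁻¹ with hcβ
  have hcβpos : 0 < cβ := by rw [hcβ]; positivity
  set T := 67 * β * N * r ^ 3 * (#(plaquettesIn (halfOpenBox d n)) : ℝ) with hT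
  -- chain the ENNReal inequalities
  have hchain : lowerConst N r ^ Fintype.card (FreeIdx d n) * (ENNReal.ofReal (Real.exp (-T)) *
      (ENNReal.ofReal cβ * (ZM (d := d) n * L) ^ (N * N))) ≤ Z d N n β := by
    refine le_trans ?_ h
    gcongr lowerConst N r ^ Fintype.card (FreeIdx d n) * (ENNReal.ofReal (Real.exp (-T)) * ?_)
    exact le_trans (by gcongr) hcube
  have hZtop : Z d N n β ≠ ∞ := ne_top_of_le_ne_top ENNReal.one_ne_top (Z_le_one n hβ0.le)
  have h2 := ENNReal.toReal_mono hZtop hchain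
  have hlc0 := lowerConst_ne_zero (N := N) r
  have hlctop := lowerConst_ne_top (N := N) r hr.le
  have hlcpos : 0 < (lowerConst N r).toReal := ENNReal.toReal_pos hlc0 hlctop
  have hLpos : 0 < L.toReal := ENNReal.toReal_pos hL0 hLtop
  have hZMr := ZM_toReal_pos (d := d) (n := n)
  have hhcc := hcc_pos (N := N)
  have hκ := κ_pos hr.le
  -- the real form of the left-hand side
  have hLHS : (lowerConst N r ^ Fintype.card (FreeIdx d n) * (ENNReal.ofReal (Real.exp (-T)) *
      (ENNReal.ofReal cβ * (ZM (d := d) n * L) ^ (N * N)))).toReal =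
      (lowerConst N r).toReal ^ Fintype.card (FreeIdx d n) * (Real.exp (-T) * (cβ * ((ZM (d := d) n).toReal * L.toReal) ^ (N * N))) := by
    rw [ENNReal.toReal_mul, ENNReal.toReal_mul, ENNReal.toReal_mul, ENNReal.toReal_pow, ENNReal.toReal_pow,
      ENNReal.toReal_mul, ENNReal.toReal_ofReal (Real.exp_pos _).le, ENNReal.toReal_ofReal hcβpos.le]
  rw [hLHS] at h2
  have hpos : 0 < (lowerConst N r).toReal ^ Fintype.card (FreeIdx d n) *
      (Real.exp (-T) * (cβ * ((ZM (d := d) n).toReal * L.toReal) ^ (N * N))) := by positivity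
  have hlog := Real.log_le_log hpos h2
  rw [logZ]
  refine le_trans (le_of_eq ?_) hlog
  have hlc : Real.log (lowerConst N r).toReal = Real.log ((haarChartConst N : ℝ≥0) : ℝ) - (N * N) * Real.log (κ r) := by
    rw [lowerConst, ENNReal.toReal_mul, ENNReal.toReal_inv, ENNReal.toReal_ofReal (by positivity), ENNReal.coe_toReal,
      Real.log_mul (by positivity) hhcc.ne', Real.log_inv, Real.log_pow]
    push_cast; ring
  rw [Real.log_mul (by positivity) (by positivity), Real.log_mul (by positivity) (by positivity),
    Real.log_mul (by positivity) (by positivity), Real.log_pow, Real.log_pow, Real.log_mul (by positivity) (by positivity),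
    Real.log_exp, hlc, hcβ, Real.log_inv, Real.log_pow, Real.log_sqrt hβ0.le]
  simp only [D₁, Pn, logZM, hT]
  push_cast
  ring

end LogBounds

end ChatterjeeAssembly

end Literature.MathematicalPhysics.QuantumFieldTheory
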